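import Summits.QuantumFields.YangMills.Theorems.F4SubCurvatureDoorShellSeparationShiftedLaplacian
import Summits.QuantumFields.YangMills.Theorems.F4SubCurvatureDoorShellSeparationMassMoments
import Summits.QuantumFields.YangMills.Theorems.F4SubCurvatureDoorMirrorAnalyticityRegistered
import Summits.QuantumFields.YangMills.Theorems.F4SubCurvatureDoorFibreDichotomyTwoPointDomination
import Summits.QuantumFields.YangMills.Theorems.F4SubCurvatureDoorFibreReductionKernel
import Mathlib
import HarnessLib

/-!
# LINE g21-A/g21-B (⟨stmt-QuantumFields-23125⟩) — S2 helper: every mass window of the Laplace–Fourier measure of a class kernel is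
# LF-symmetric (the heart of shell separation)

Helper toward the registered stub S2 `stub_shellSeparation`.  For a class kernel `K` (`InClass`) with Laplace–Fourier measure `μ` (`IsLF`) and no
deep space-like mass (`μ{E² − ‖q⃗‖² < −Q₀} = 0`), and for every measurable mass window `S`, the window measure `μ|{massSq ∈ S}` is
LF-SYMMETRIC: `lfEval (μ|S) (R x) = lfEval (μ|S) x` for every `D₄`-isometry `R` and all `x` with `x₀ ≠ 0 ≠ (Rx)₀` (`symmetricLF_window`).

Mechanism (steps (1)–(4) of `Lines/shell_separation.lean`): `K` is smooth off the origin (✓`stub_mirrorAnalyticity`); off the mirror the iterated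
shifted Laplacian `(Δ + Q₀)^k K` is the Laplace–Fourier integral weighted by `(massSq + Q₀)^k` (✓`shiftedLaplacian_iterate_eq`, with the time
reflection for `x₀ < 0`); it is `D₄`-invariant because `Δ` commutes with isometries (✓`shiftedLaplacian_iterate_invariant`); so the signed density
`e^{−|(Rx)₀|E}cos⟪q⃗,(Rx)⃗⟫ − e^{−|x₀|E}cos⟪q⃗,x⃗⟫` has vanishing shifted-mass moments, hence vanishing mass-window integrals
(✓`setIntegral_eq_zero_of_moments`, R-S2c).

Mathlib + tree only; no `sorry`; no new definitions.  HONEST LABEL: helper for a registered stub of an OPEN line; S1, S2, ⟨23125⟩, ⟨23035⟩, R2d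
and the Yang–Mills mass gap remain OPEN; no summit is proved by a line.
-/

noncomputable section

open MeasureTheory Set Filter Topology InnerProductSpace
open scoped BigOperators Laplacian

namespace Summit.QuantumFields.YangMills.Theorems.F4SubCurvatureDoorShellSeparationProof

open Summit.QuantumFields.YangMills.Theorems.F4SubCurvatureDoorLaplaceFourierRegistered (E4 E3 InClass timeSpace IsLF)
open Summit.QuantumFields.YangMills.Theorems.F4SubCurvatureDoorFibreDichotomyAxis (spacePart lfEval IsD4Isometry SymmetricLF signIso
  signIso_apply isD4Isometry_signIso)
open Summit.QuantumFields.YangMills.Theorems.F4SubCurvatureDoorShellLFAnalytic (massSq spacePart_apply timeSpace_self)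
open Summit.QuantumFields.YangMills.Theorems.F4SubCurvatureDoorSmearedSlices (ae_nonneg_of_measure_Iio)
open Summit.QuantumFields.YangMills.Theorems.F4SubCurvatureDoorMirrorAnalyticityRegistered (stub_mirrorAnalyticity)
open Summit.QuantumFields.YangMills.Theorems.F4SubCurvatureDoorFibreReduction (timeReflection_apply_zero)

variable {μ : Measure (ℝ × E3)}

/-! ## Consequences of «no deep space-like mass» -/

/-- Under `E ≥ 0` and `−Q₀ ≤ massSq`: `‖q⃗‖ ≤ E + √|Q₀|` a.e. -/
theorem ae_norm_le (h0 : μ (Set.Iio (0 : ℝ) ×ˢ (Set.univ : Set E3)) = 0) {Q₀ : ℝ} (hQ : μ {p | massSq p < -Q₀} = 0) :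
    ∀ᵐ p ∂μ, ‖p.2‖ ≤ p.1 + Real.sqrt |Q₀| := by
  filter_upwards [ae_nonneg_of_measure_Iio μ h0, measure_eq_zero_iff_ae_notMem.1 hQ] with p hE hp
  have hm : -Q₀ ≤ massSq p := not_lt.1 hp
  rw [massSq] at hm
  have hs : (Real.sqrt |Q₀|) ^ 2 = |Q₀| := Real.sq_sqrt (abs_nonneg _)
  have h1 : ‖p.2‖ ^ 2 ≤ (p.1 + Real.sqrt |Q₀|) ^ 2 := by
    nlinarith [le_abs_self Q₀, Real.sqrt_nonneg |Q₀|, mul_nonneg hE (Real.sqrt_nonneg |Q₀|)]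
  exact (pow_le_pow_iff_left₀ (norm_nonneg _) (by positivity) two_ne_zero).1 h1

/-! ## The time reflection -/

/-- The time reflection fixes the spatial part. -/
theorem spacePart_timeReflection (x : E4) : spacePart (signIso ![false, true, true, true] x) = spacePart x := by
  ext j
  rw [spacePart_apply, spacePart_apply, signIso_apply]
  have : (![false, true, true, true] : Fin 4 → Bool) j.succ = true := by
    fin_cases j <;> rfl
  rw [this]
  rfl

/-! ## The shifted-mass moments of the off-mirror densities -/

/-- **The weighted Laplace–Fourier integrals at an off-mirror point are the iterated shifted Laplacians of `K`** (both signs of `x₀`). -/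
theorem moment_eq_iterate (K : E4 → ℝ) (hK : InClass K) (hLF : IsLF K μ) {Q₀ : ℝ} (hQ : μ {p | massSq p < -Q₀} = 0)
    (k : ℕ) {x : E4} (hx : x 0 ≠ 0) :
    ∫ p, (massSq p + Q₀) ^ k * Real.exp (-(|x 0| * p.1)) * Real.cos (inner ℝ p.2 (spacePart x)) ∂μ =
      ((fun g : E4 → ℝ => fun y => (Δ g) y + Q₀ * g y)^[k] K) x := by
  obtain ⟨h0, hint, hrep0⟩ := hLF
  have hKs : ∀ y : E4, y ≠ 0 → ContDiffAt ℝ ⊤ K y := fun y hy => (stub_mirrorAnalyticity K hK y hy).contDiffAt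
  have hrep : ∀ y : E4, 0 < y 0 → K y = ∫ p, Real.exp (-(y 0 * p.1)) * Real.cos (inner ℝ p.2 (spacePart y)) ∂μ := by
    intro y hy
    have := hrep0 (y 0) (spacePart y) hy
    rwa [timeSpace_self] at this
  have hA : (0 : ℝ) ≤ Real.sqrt |Q₀| := Real.sqrt_nonneg _
  have key := shiftedLaplacian_iterate_eq h0 hint hA (ae_norm_le h0 hQ) Q₀ hKs hrep k
  rcases lt_or_gt_of_ne hx with hneg | hpos
  · -- negative time: reflect
    set θ := signIso ![false, true, true, true] with hθ
    have hinvθ : ∀ y : E4, K (θ y) = K y := fun y => hK.2.2.2.2.2 θ (isD4Isometry_signIso _) y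
    have hθ0 : 0 < (θ x) 0 := by rw [hθ, timeReflection_apply_zero]; linarith
    rw [← shiftedLaplacian_iterate_invariant hinvθ Q₀ k x, key (θ x) hθ0, hθ, timeReflection_apply_zero, spacePart_timeReflection,
      abs_of_neg hneg]
  · rw [key x hpos, abs_of_pos hpos]

/-! ## Window symmetry -/

/-- **Every mass window of the Laplace–Fourier measure of a class kernel is LF-symmetric** (the heart of S2 «shell separation»). -/
theorem symmetricLF_window (K : E4 → ℝ) (hK : InClass K) (hLF : IsLF K μ) {Q₀ : ℝ} (hQ : μ {p | massSq p < -Q₀} = 0)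
    {S : Set ℝ} (hS : MeasurableSet S) : SymmetricLF (μ.restrict (massSq ⁻¹' S)) := by
  intro R hR x hx hRx
  obtain ⟨h0, hint, hrep0⟩ := hLF
  have hE := ae_nonneg_of_measure_Iio μ h0
  have hA : (0 : ℝ) ≤ Real.sqrt |Q₀| := Real.sqrt_nonneg _
  have hq := ae_norm_le h0 hQ
  -- the two densities and their difference
  set t₁ : ℝ := |x 0| with ht₁
  set t₂ : ℝ := |(R x) 0| with ht₂
  have ht₁p : 0 < t₁ := abs_pos.2 hx
  have ht₂p : 0 < t₂ := abs_pos.2 hRx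
  set f : ℝ × E3 → ℝ := fun p => Real.exp (-(t₂ * p.1)) * Real.cos (inner ℝ p.2 (spacePart (R x)))
    - Real.exp (-(t₁ * p.1)) * Real.cos (inner ℝ p.2 (spacePart x)) with hf
  have hfc : Continuous f := by simp only [hf]; fun_prop
  set t : ℝ := min t₁ t₂ with ht
  have htp : 0 < t := lt_min ht₁p ht₂p
  have hfb : ∀ᵐ p ∂μ, |f p| ≤ 2 * Real.exp (-(t * p.1)) := by
    filter_upwards [hE] with p hp
    have h1 : |Real.exp (-(t₂ * p.1)) * Real.cos (inner ℝ p.2 (spacePart (R x)))| ≤ Real.exp (-(t * p.1)) := by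
      rw [abs_mul, abs_of_pos (Real.exp_pos _)]
      calc Real.exp (-(t₂ * p.1)) * |Real.cos _| ≤ Real.exp (-(t₂ * p.1)) * 1 :=
            mul_le_mul_of_nonneg_left (Real.abs_cos_le_one _) (Real.exp_pos _).le
        _ ≤ Real.exp (-(t * p.1)) := by rw [mul_one]; exact Real.exp_le_exp.2 (by nlinarith [min_le_right t₁ t₂])
    have h2 : |Real.exp (-(t₁ * p.1)) * Real.cos (inner ℝ p.2 (spacePart x))| ≤ Real.exp (-(t * p.1)) := by
      rw [abs_mul, abs_of_pos (Real.exp_pos _)]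
      calc Real.exp (-(t₁ * p.1)) * |Real.cos _| ≤ Real.exp (-(t₁ * p.1)) * 1 :=
            mul_le_mul_of_nonneg_left (Real.abs_cos_le_one _) (Real.exp_pos _).le
        _ ≤ Real.exp (-(t * p.1)) := by rw [mul_one]; exact Real.exp_le_exp.2 (by nlinarith [min_le_left t₁ t₂])
    calc |f p| ≤ |Real.exp (-(t₂ * p.1)) * Real.cos (inner ℝ p.2 (spacePart (R x)))| +
        |Real.exp (-(t₁ * p.1)) * Real.cos (inner ℝ p.2 (spacePart x))| := abs_sub _ _
      _ ≤ 2 * Real.exp (-(t * p.1)) := by linarith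
  -- the shifted-mass moments of `f` vanish
  have hWm : ∀ k : ℕ, Measurable fun p : ℝ × E3 => (massSq p + Q₀) ^ k := fun k =>
    (continuous_massSq.add continuous_const).measurable.pow_const k
  have hI : ∀ (k : ℕ) {s : ℝ} (hs : 0 < s) (z : E3), Integrable
      (fun p : ℝ × E3 => (massSq p + Q₀) ^ k * Real.exp (-(s * p.1)) * Real.cos (inner ℝ p.2 z)) μ := fun k s hs z =>
    integrable_weight h0 hint (hWm k) (massPow_bound h0 hA hq Q₀ k) (by fun_prop) (fun p => Real.abs_cos_le_one _) hs
  have hmomint : ∀ k : ℕ, Integrable (fun p : ℝ × E3 => (massSq p + Q₀) ^ k * f p) μ := by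
    intro k
    have e : (fun p : ℝ × E3 => (massSq p + Q₀) ^ k * f p) = fun p =>
        (massSq p + Q₀) ^ k * Real.exp (-(t₂ * p.1)) * Real.cos (inner ℝ p.2 (spacePart (R x)))
        - (massSq p + Q₀) ^ k * Real.exp (-(t₁ * p.1)) * Real.cos (inner ℝ p.2 (spacePart x)) := by
      funext p; simp only [hf]; ring
    rw [e]
    exact (hI k ht₂p _).sub (hI k ht₁p _)
  have hmom : ∀ k : ℕ, ∫ p, (massSq p + Q₀) ^ k * f p ∂μ = 0 := by
    intro k
    have e : (fun p : ℝ × E3 => (massSq p + Q₀) ^ k * f p) = fun p =>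
        (massSq p + Q₀) ^ k * Real.exp (-(t₂ * p.1)) * Real.cos (inner ℝ p.2 (spacePart (R x)))
        - (massSq p + Q₀) ^ k * Real.exp (-(t₁ * p.1)) * Real.cos (inner ℝ p.2 (spacePart x)) := by
      funext p; simp only [hf]; ring
    rw [e, integral_sub (hI k ht₂p _) (hI k ht₁p _), ht₂, ht₁,
      moment_eq_iterate K hK ⟨h0, hint, hrep0⟩ hQ k hRx, moment_eq_iterate K hK ⟨h0, hint, hrep0⟩ hQ k hx,
      shiftedLaplacian_iterate_invariant (hK.2.2.2.2.2 R hR) Q₀ k x, sub_self]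
  have hzero := setIntegral_eq_zero_of_moments h0 hint Q₀ (by
    filter_upwards [measure_eq_zero_iff_ae_notMem.1 hQ] with p hp; exact not_lt.1 hp) hfc htp hfb hmomint hmom hS
  -- read off `lfEval`
  have hi2 : Integrable (fun p : ℝ × E3 => Real.exp (-(t₂ * p.1)) * Real.cos (inner ℝ p.2 (spacePart (R x))))
      (μ.restrict (massSq ⁻¹' S)) := by
    have := hI 0 ht₂p (spacePart (R x)); simp only [pow_zero, one_mul] at this; exact this.restrict
  have hi1 : Integrable (fun p : ℝ × E3 => Real.exp (-(t₁ * p.1)) * Real.cos (inner ℝ p.2 (spacePart x)))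
      (μ.restrict (massSq ⁻¹' S)) := by
    have := hI 0 ht₁p (spacePart x); simp only [pow_zero, one_mul] at this; exact this.restrict
  have hsub : ∫ p in massSq ⁻¹' S, f p ∂μ =
      (∫ p in massSq ⁻¹' S, Real.exp (-(t₂ * p.1)) * Real.cos (inner ℝ p.2 (spacePart (R x))) ∂μ) -
        ∫ p in massSq ⁻¹' S, Real.exp (-(t₁ * p.1)) * Real.cos (inner ℝ p.2 (spacePart x)) ∂μ := by
    rw [← integral_sub hi2 hi1]
  rw [hsub] at hzero
  show ∫ p, Real.exp (-(|(R x) 0| * p.1)) * Real.cos (inner ℝ p.2 (spacePart (R x))) ∂(μ.restrict (massSq ⁻¹' S)) =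
    ∫ p, Real.exp (-(|x 0| * p.1)) * Real.cos (inner ℝ p.2 (spacePart x)) ∂(μ.restrict (massSq ⁻¹' S))
  linarith

end Summit.QuantumFields.YangMills.Theorems.F4SubCurvatureDoorShellSeparationProof

end
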